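import Summits.AtomisticToContinuum.BoseEinsteinCondensation.Theorems.BECGroundStateSOSPeriodicIRBoundTwoSectorPairDefs
import HarnessLib

/-!
# Route `BECGroundStateSOS`, crux `PeriodicIRBound` (stmt-AtomisticToContinuum-3972), line `two-sector-gd-transfer` (v11) —
# stub S11d₁ `stub_pairSharesReal : PairSharesReal`

Supports (does not close) stmt-AtomisticToContinuum-3972. Lead seat c23 (`Cruxes/PeriodicIRBound/SOFT-LOCATION.md`, Steps 1
and 5). PURE REAL ALGEBRA: at one momentum-zero near-minimiser, with occupation `0 ≤ nk ≤ Bm`, hole/particle test-vector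
energies `qA, qC`, ground energies `e0 = E₀(N)`, `e0m = E₀(N−1)`, `e0p = E₀(N+1)`, the variational bounds `e0m·nk ≤ qA`,
`e0p(nk+1) ≤ qC`, `e0 ≤ e0p`, an f-sum lower bound `Fl ≤ qA + qC − e0(2nk+1)` and the numeric gap
`(Bm+1)(2Bm+1) ≤ b(Fl − (e0 − e0m))`, there is a chemical potential `μ ≥ −(Bm+1)/b` carrying BOTH `η`-regularised
Kennedy–Lieb–Shastry shares against the thresholds `e0 ± μ`.

Proof. `P := qC − e0(nk+1) ≥ 0`, `M := qA − e0·nk ≥ −(e0 − e0m)nk`, so `b(nk·P + (nk+1)M) = b(nk(P+M) + M) ≥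
nk·b(Fl − (e0−e0m)) ≥ nk(Bm+1)(2Bm+1) ≥ nk(nk+1)(2nk+1)` — the solvability condition of
`nk/b − M/nk ≤ μ ≤ P/(nk+1) − (nk+1)/b`. For `nk = 0` take `μ := P − 1/b`; for `nk > 0` take
`μ := max (nk/b − M/nk) (−(Bm+1)/b)`: the hole share holds because `μ ≥ nk/b − M/nk`, the particle share in the first
branch by solvability and in the second because `P ≥ 0` and `Bm ≥ nk`. Elementary; nothing is cited.
-/

namespace Summit.AtomisticToContinuum.BoseEinsteinCondensation.Cruxes.PeriodicIRBound.TwoSectorGdTransfer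

namespace PairShares

/-- Regularisation: a share `y² ≤ b·S` with `S ≥ 0`, `y ≥ 0`, `b ≥ 0`, `η ≥ 0` gives the `η`-regularised share. [folklore] -/
theorem regularise {y b S η : ℝ} (hb : 0 ≤ b) (hy : 0 ≤ y) (hη : 0 ≤ η) (hS : 0 ≤ S) (h : y ^ 2 ≤ b * S) :
    y ^ 2 ≤ b * ((1 + η) * S + η * y) := by
  have h1 : b * S ≤ b * ((1 + η) * S + η * y) := by
    apply mul_le_mul_of_nonneg_left _ hb
    nlinarith [mul_nonneg hη hS, mul_nonneg hη hy]
  exact h.trans h1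

/-- The case `nk = 0`: `μ := P − 1/b`. [folklore] -/
theorem shares_zero {qA qC e0 b Bm η : ℝ} (hb : 0 < b) (hBm : 0 ≤ Bm) (hη : 0 < η) (hqA : 0 ≤ qA)
    (hP : 0 ≤ qC - e0) :
    ∃ μ : ℝ, -((Bm + 1) / b) ≤ μ ∧
      ((0 : ℝ) + 1) ^ 2 ≤ b * ((1 + η) * (qC - (e0 + μ) * (0 + 1)) + η * (0 + 1)) ∧
      (0 : ℝ) ^ 2 ≤ b * ((1 + η) * (qA - (e0 - μ) * 0) + η * 0) := by
  refine ⟨qC - e0 - 1 / b, ?_, ?_, ?_⟩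
  · have h1 : 1 / b ≤ (Bm + 1) / b := div_le_div_of_nonneg_right (by linarith) hb.le
    linarith
  · have h2 : b * ((1 + η) * (qC - (e0 + (qC - e0 - 1 / b)) * (0 + 1)) + η * (0 + 1)) = (1 + η) + b * η := by
      field_simp
      ring
    rw [h2]
    nlinarith [mul_pos hb hη]
  · have h3 : b * ((1 + η) * (qA - (e0 - (qC - e0 - 1 / b)) * 0) + η * 0) = b * ((1 + η) * qA) := by ring
    rw [h3]
    have : 0 ≤ (1 + η) * qA := mul_nonneg (by linarith) hqA
    nlinarith [mul_nonneg hb.le this]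

/-- The case `nk > 0`: `μ := max (nk/b − M/nk) (−(Bm+1)/b)`. [folklore] -/
theorem shares_pos {nk qA qC e0 b Bm η : ℝ} (hb : 0 < b) (hnk : 0 < nk) (hnkB : nk ≤ Bm) (hη : 0 < η)
    (hP : 0 ≤ qC - e0 * (nk + 1))
    (hstar : nk * (nk + 1) * (2 * nk + 1) ≤ b * (nk * (qC - e0 * (nk + 1)) + (nk + 1) * (qA - e0 * nk))) :
    ∃ μ : ℝ, -((Bm + 1) / b) ≤ μ ∧
      (nk + 1) ^ 2 ≤ b * ((1 + η) * (qC - (e0 + μ) * (nk + 1)) + η * (nk + 1)) ∧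
      nk ^ 2 ≤ b * ((1 + η) * (qA - (e0 - μ) * nk) + η * nk) := by
  set P : ℝ := qC - e0 * (nk + 1) with hPdef
  set M : ℝ := qA - e0 * nk with hMdef
  set lo : ℝ := nk / b - M / nk with hlo
  set μ : ℝ := max lo (-((Bm + 1) / b)) with hμ
  have hnk0 : nk ≠ 0 := hnk.ne'
  have hb0 : b ≠ 0 := hb.ne'
  refine ⟨μ, le_max_right _ _, ?_, ?_⟩
  · -- particle share: `S₊ := P − μ(nk+1) ≥ (nk+1)²/b`
    have hSp : (nk + 1) ^ 2 ≤ b * (P - μ * (nk + 1)) := by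
      rcases le_total lo (-((Bm + 1) / b)) with hcase | hcase
      · -- `μ = −(Bm+1)/b`
        have hμeq : μ = -((Bm + 1) / b) := max_eq_right hcase
        rw [hμeq]
        have h1 : b * (P - -((Bm + 1) / b) * (nk + 1)) = b * P + (Bm + 1) * (nk + 1) := by
          field_simp
          ring
        rw [h1]
        nlinarith [mul_nonneg hb.le hP]
      · -- `μ = lo`
        have hμeq : μ = lo := max_eq_left hcase
        rw [hμeq, hlo]
        have h1 : b * (P - (nk / b - M / nk) * (nk + 1)) = (b * (nk * P + (nk + 1) * M) - nk * nk * (nk + 1)) / nk := by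
          field_simp
          ring
        rw [h1, le_div_iff₀ hnk]
        nlinarith [hstar]
    have hSp0 : 0 ≤ P - μ * (nk + 1) := by
      by_contra h
      push Not at h
      have : b * (P - μ * (nk + 1)) < 0 := mul_neg_of_pos_of_neg hb h
      nlinarith [sq_nonneg (nk + 1)]
    have key := regularise hb.le (by linarith : (0 : ℝ) ≤ nk + 1) hη.le hSp0 hSp
    have hrw : qC - (e0 + μ) * (nk + 1) = P - μ * (nk + 1) := by rw [hPdef]; ring
    rw [hrw]
    exact key
  · -- hole share: `S₋ := M + μ·nk ≥ nk²/b` because `μ ≥ lo`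
    have hμlo : lo ≤ μ := le_max_left _ _
    have hSm : nk ^ 2 ≤ b * (M + μ * nk) := by
      have h1 : b * (M + lo * nk) = nk ^ 2 := by
        rw [hlo]
        field_simp
        ring
      have h2 : b * (M + lo * nk) ≤ b * (M + μ * nk) := by
        apply mul_le_mul_of_nonneg_left _ hb.le
        nlinarith [mul_le_mul_of_nonneg_right hμlo hnk.le]
      linarith
    have hSm0 : 0 ≤ M + μ * nk := by
      by_contra h
      push Not at h
      have : b * (M + μ * nk) < 0 := mul_neg_of_pos_of_neg hb h
      nlinarith [sq_nonneg nk]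
    have key := regularise hb.le hnk.le hη.le hSm0 hSm
    have hrw : qA - (e0 - μ) * nk = M + μ * nk := by rw [hMdef]; ring
    rw [hrw]
    exact key

end PairShares

/-- **Stub S11d₁ of the line `two-sector-gd-transfer` (v11)** — the per-state Kennedy–Lieb–Shastry shares from an f-sum
gap (pure real algebra; `Cruxes/PeriodicIRBound/SOFT-LOCATION.md` Steps 1 and 5). [folklore] -/
theorem stub_pairSharesReal : PairSharesReal := by
  intro nk qA qC e0 e0m e0p b Bm Fl η hb hnk hnkB hη hA hC hep hF hgap
  have hBm : 0 ≤ Bm := hnk.trans hnkB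
  -- `P ≥ 0`
  have hP : 0 ≤ qC - e0 * (nk + 1) := by nlinarith [mul_le_mul_of_nonneg_right hep (by linarith : (0 : ℝ) ≤ nk + 1)]
  rcases hnk.eq_or_lt with h0 | hpos
  · -- `nk = 0`
    subst h0
    have hqA : 0 ≤ qA := by simpa using hA
    have hP' : 0 ≤ qC - e0 := by simpa using hP
    simpa using PairShares.shares_zero hb hBm hη hqA hP'
  · -- `nk > 0`: solvability from the f-sum gap
    have hstar : nk * (nk + 1) * (2 * nk + 1) ≤
        b * (nk * (qC - e0 * (nk + 1)) + (nk + 1) * (qA - e0 * nk)) := by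
      -- `b(nk P + (nk+1) M) = b(nk(P+M) + M) ≥ nk·b(Fl − (e0−e0m)) ≥ nk(Bm+1)(2Bm+1) ≥ nk(nk+1)(2nk+1)`
      have h1 : nk * (qC - e0 * (nk + 1)) + (nk + 1) * (qA - e0 * nk) =
          nk * (qA + qC - e0 * (2 * nk + 1)) + (qA - e0 * nk) := by ring
      have h2 : nk * Fl + (e0m - e0) * nk ≤ nk * (qA + qC - e0 * (2 * nk + 1)) + (qA - e0 * nk) := by
        nlinarith [mul_le_mul_of_nonneg_left hF hpos.le]
      have h3 : nk * ((Bm + 1) * (2 * Bm + 1)) ≤ nk * (b * (Fl - (e0 - e0m))) :=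
        mul_le_mul_of_nonneg_left hgap hpos.le
      have h4 : nk * (nk + 1) * (2 * nk + 1) ≤ nk * ((Bm + 1) * (2 * Bm + 1)) := by
        have : (nk + 1) * (2 * nk + 1) ≤ (Bm + 1) * (2 * Bm + 1) := by nlinarith
        nlinarith [mul_le_mul_of_nonneg_left this hpos.le]
      rw [h1]
      nlinarith [mul_le_mul_of_nonneg_left h2 hb.le]
    exact PairShares.shares_pos hb hpos hnkB hη hP hstar

end Summit.AtomisticToContinuum.BoseEinsteinCondensation.Cruxes.PeriodicIRBound.TwoSectorGdTransfer
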